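import Summits.ResolutionOfSingularities.ResolutionOfSingularities.Theses.PAlteration
import Literature.AlgebraicGeometry.Resolution.NormalizationInSeparable
import Literature.AlgebraicGeometry.Resolution.FiniteBirationalNormal
import Literature.AlgebraicGeometry.Resolution.RegularLocalRingsNormal
import Mathlib.AlgebraicGeometry.Morphisms.UniversallyInjective

/-!
# Crux `Picover` (stmt-ResolutionOfSingularities-0554), line `degree-p-tower`: `Picover` implies its degree-`p` residue

The line `degree-p-tower` reduces the crux
`Summit.ResolutionOfSingularities.ResolutionOfSingularities.Theses.PAlteration.Picover` (finite,
universally injective, surjective covers `X → Y` of regular integral separated finite-type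
`k`-schemes `Y`, `char k = p`, have resolutions) to its degree-`p` RESIDUE: for `W` a regular
integral separated finite-type `k`-scheme and `L ⊇ K(W)` purely inseparable of degree `p`, the
normalization `W^L = normalizationIn W L` of `W` in `L` has a resolution. This file proves the
CONVERSE direction, making "crux ⟺ residue" formal:

**Statement** (`picoverDegP_of_picover`). `Picover →` (the residue, for every prime `p` and field
`k` of characteristic `p`).

**Proof.** Apply `Picover` to `Y := W`, `X := W^L`, `g := ι : W^L → W` the normalization morphism.
`W^L` is integral; `ι` is finite (E. Noether, `isFinite_normalizationInι`) and surjective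
(`surjective_normalizationInι`). The work is `UniversallyInjective ι` (Stacks 01S2–01S4):

* *Algebra.* `L/K(W)` purely inseparable of degree `p` with `char K(W) = p`: every `x ∈ L` has
  minimal polynomial `X^{p^n} - y`, of degree `p^n ≤ [L : K(W)] = p`, so `n ≤ 1` and `x^p ∈ K(W)`.
* *Rings.* If `φ : A → B` is a ring map with `char A = p` and every `b ∈ B` has `b^p ∈ φ(A)`, then
  `Spec B → Spec A` is universally injective: by the `K`-points criterion
  (`tfae_universallyInjective`), two ring maps `ψ₁, ψ₂ : B → K` to a field agreeing on `φ(A)`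
  satisfy `ψ₁(b)^p = ψ₂(b)^p`, and Frobenius is injective on the field `K` (of characteristic `p`).
* *Geometry.* Universal injectivity is Zariski-local on the target; over a non-empty affine open
  `U = Spec A` of `W` (`A` a normal domain with `Frac A = K(W)`: the local rings of the regular
  `W` are integrally closed, Matsumura 19.4) the morphism `ι` is `Spec C → Spec A`, `C` the
  integral closure of `A` in `Γ(Spec L, ξ_L⁻¹U) ≅ L`; for `b ∈ C`, `b^p = c ∈ K(W)` is integral
  over `A`, hence in `A`.

Sources: The Stacks Project, Tags 01S2–01S4 (universally injective = radicial); Q. Liu,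
*Algebraic Geometry and Arithmetic Curves* (2002), 4.1.24–4.1.27; H. Matsumura, *Commutative Ring
Theory* (1987), Thm. 19.4.
-/

noncomputable section

set_option linter.dupNamespace false -- mandated namespace of this single-conjunct summit

open CategoryTheory AlgebraicGeometry TopologicalSpace
open Literature.AlgebraicGeometry.Resolution Literature.AlgebraicGeometry.Motives

namespace Summit.ResolutionOfSingularities.ResolutionOfSingularities.Theorems.Picover.DegPOfPicover

universe u

/-! ## Algebra: degree-`p` purely inseparable extensions -/

/-- In a purely inseparable extension `L/K` of degree `p = char K` (a prime), the `p`-th power of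
every element of `L` lies in `K`: the minimal polynomial of `x` is `X^{p^n} - y` of degree
`p^n ≤ [L : K] = p`, so `n ≤ 1`. [folklore] -/
theorem exists_pow_eq_algebraMap {K L : Type*} [Field K] [Field L] [Algebra K L] {p : ℕ}
    (hp : p.Prime) [ExpChar K p] [IsPurelyInseparable K L] (hdeg : Module.finrank K L = p)
    (x : L) : ∃ c : K, x ^ p = algebraMap K L c := by
  haveI : FiniteDimensional K L := Module.finite_of_finrank_pos (hdeg ▸ hp.pos)
  obtain ⟨n, y, h⟩ := IsPurelyInseparable.minpoly_eq_X_pow_sub_C K p x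
  have hxn : x ^ p ^ n = algebraMap K L y := by
    have := minpoly.aeval K x
    rwa [h, map_sub, map_pow, Polynomial.aeval_X, Polynomial.aeval_C, sub_eq_zero] at this
  have hn : n ≤ 1 := by
    have h1 : (minpoly K x).natDegree = p ^ n := by
      rw [h, Polynomial.natDegree_X_pow_sub_C]
    have h2 : (minpoly K x).natDegree ≤ p := hdeg ▸ minpoly.natDegree_le x
    rw [h1] at h2
    by_contra hn1
    have h3 : p ^ 1 < p ^ n := Nat.pow_lt_pow_right hp.one_lt (by omega)
    rw [pow_one] at h3
    omega
  refine ⟨y ^ p ^ (1 - n), ?_⟩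
  rw [map_pow, ← hxn, ← pow_mul, ← pow_add, Nat.add_sub_cancel' hn, pow_one]

/-! ## Rings: `Spec B → Spec A` is universally injective when `B^p ⊆ A` -/

/-- **Radicial ring maps.** Let `φ : R → S` be a ring map with `char R = p` prime such that the
`p`-th power of every element of `S` lies in the image of `φ`. Then `Spec S → Spec R` is
universally injective: two `K`-points `ψ₁, ψ₂ : S → K` (`K` a field) which agree on `φ(R)` satisfy
`ψ₁(b)^p = ψ₂(b)^p`, and the Frobenius of `K` (of characteristic `p`) is injective
(Stacks 01S2–01S4). [folklore] -/
theorem universallyInjective_SpecMap_of_forall_pow_eq {R S : CommRingCat.{u}} (φ : R ⟶ S)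
    {p : ℕ} (hp : p.Prime) [CharP R p] (h : ∀ b : S, ∃ a : R, b ^ p = φ a) :
    UniversallyInjective (Spec.map φ) := by
  refine ((tfae_universallyInjective (Spec.map φ)).out 0 1).mpr ?_
  intro K _ a₁ a₂ h12
  obtain ⟨ψ₁, rfl⟩ := Spec.map_surjective a₁
  obtain ⟨ψ₂, rfl⟩ := Spec.map_surjective a₂
  have h12' : Spec.map (φ ≫ ψ₁) = Spec.map (φ ≫ ψ₂) := by
    simpa only [Spec.map_comp] using h12
  have hφψ : φ ≫ ψ₁ = φ ≫ ψ₂ := Spec.map_injective h12'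
  -- `K` has characteristic `p`: it receives the ring map `ψ₁ ∘ φ` from `R`
  haveI : CharP K p := by
    rw [CharP.charP_iff_prime_eq_zero hp]
    rw [← map_natCast (φ ≫ ψ₁).hom p, CharP.cast_eq_zero, map_zero]
  haveI : ExpChar K p := ExpChar.prime hp
  congr 1
  ext b
  obtain ⟨a, ha⟩ := h b
  apply frobenius_inj K p
  rw [frobenius_def, frobenius_def]
  change (ψ₁.hom b) ^ p = (ψ₂.hom b) ^ p
  rw [← map_pow, ← map_pow, ha]
  exact congr(($hφψ).hom a)

/-! ## Geometry: the normalization in a degree-`p` purely inseparable extension is radicial -/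

/-- **Charts.** Let `ι : N → Y` be a morphism, `U ⊆ Y` an affine open and `chart : Spec C → N`
an open immersion onto `ι⁻¹ U` over which `ι` is `Spec (φ : Γ(Y, U) → C)`. If `Spec φ` is
universally injective then so is the restriction `ι ∣_ U` (the two arrows are isomorphic).
[folklore] -/
theorem universallyInjective_morphismRestrict_of_chart {N Y : Scheme.{u}} (ι : N ⟶ Y)
    {U : Y.Opens} (hU : IsAffineOpen U) {C : CommRingCat.{u}} (chart : Spec C ⟶ N)
    [hci : IsOpenImmersion chart] (φ : Γ(Y, U) ⟶ C) (hrange : ι ⁻¹ᵁ U = chart.opensRange)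
    (hchart : chart ≫ ι = Spec.map φ ≫ hU.fromSpec) (hφ : UniversallyInjective (Spec.map φ)) :
    UniversallyInjective (ι ∣_ U) := by
  have hr : Set.range (ι ⁻¹ᵁ U).ι = Set.range chart := by
    rw [Scheme.Opens.range_ι, hrange, Scheme.Hom.coe_opensRange]
  rw [← MorphismProperty.cancel_left_of_respectsIso @UniversallyInjective
      (IsOpenImmersion.isoOfRangeEq _ chart hr).inv,
    ← MorphismProperty.cancel_right_of_respectsIso @UniversallyInjective _ hU.isoSpec.hom]
  have heq : ((IsOpenImmersion.isoOfRangeEq _ chart hr).inv ≫ ι ∣_ U) ≫ hU.isoSpec.hom =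
      Spec.map φ := by
    rw [← cancel_mono hU.fromSpec]
    simp only [Category.assoc, IsAffineOpen.isoSpec_hom_fromSpec, morphismRestrict_ι,
      IsOpenImmersion.isoOfRangeEq_inv_fac_assoc]
    exact hchart
  rw [heq]
  exact hφ

section Chart

variable {p : ℕ} (W : Scheme.{u}) [IsIntegral W] (L : Type u) [Field L]
  [Algebra W.functionField L]

/-- Over a non-empty affine open `U = Spec A` of an integral scheme `W` all of whose local rings
are integrally closed, every element `b` of the integral closure `C` of `A` in
`Γ(Spec L, ξ_L⁻¹ U) ≅ L`, for `L ⊇ K(W)` purely inseparable of degree `p = char K(W)`, has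
`b^p ∈ A`: `b^p = c ∈ K(W) = Frac A` is integral over the normal domain `A`. [folklore] -/
theorem exists_pow_eq_app (hp : p.Prime) [ExpChar W.functionField p]
    [IsPurelyInseparable W.functionField L] (hdeg : Module.finrank W.functionField L = p)
    (hW : ∀ x : W, IsIntegrallyClosed (W.presheaf.stalk x)) (U : W.affineOpens)
    [hU : Nonempty (U : W.Opens)] :
    letI := ((fromSpecExtension W L).app U).hom.toAlgebra
    ∀ b : integralClosure Γ(W, U) Γ(Spec (.of L), fromSpecExtension W L ⁻¹ᵁ U),
      ∃ a : Γ(W, U), (b : Γ(Spec (.of L), fromSpecExtension W L ⁻¹ᵁ U)) ^ p =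
        (fromSpecExtension W L).app U a := by
  letI algS := ((fromSpecExtension W L).app U).hom.toAlgebra
  have hUne : ((U : W.Opens) : Set W).Nonempty := by
    obtain ⟨x⟩ := hU
    exact ⟨x.1, x.2⟩
  haveI : IsIntegrallyClosed Γ(W, U) := isIntegrallyClosed_sections_of_stalk hW U
  haveI : IsFractionRing Γ(W, U) W.functionField :=
    functionField_isFractionRing_of_isAffineOpen W U U.2
  -- `L` as a `Γ(W, U)`-algebra through `K(W)`
  letI algL : Algebra Γ(W, U) L :=
    ((algebraMap W.functionField L).comp (W.germToFunctionField U).hom).toAlgebra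
  haveI : IsScalarTower Γ(W, U) W.functionField L :=
    IsScalarTower.of_algebraMap_eq (R := Γ(W, U)) (S := W.functionField) (A := L) fun a => rfl
  -- the `Γ(W, U)`-algebra isomorphism `L ≅ Γ(Spec L, ξ_L⁻¹ U)`
  let e : L ≃ₐ[Γ(W, U)] Γ(Spec (.of L), fromSpecExtension W L ⁻¹ᵁ U) :=
    { (extensionIsoSections (X := W) (L := L) hUne).commRingCatIsoToRingEquiv with
      commutes' := fun a => (fromSpecExtension_app_apply (X := W) (L := L) hUne a).symm }
  intro b
  have hx : IsIntegral Γ(W, U) (e.symm b) := (isIntegral_algEquiv e.symm).mpr b.2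
  obtain ⟨c, hc⟩ := exists_pow_eq_algebraMap hp hdeg (e.symm b)
  have hcint : IsIntegral Γ(W, U) c := by
    have h1 : IsIntegral Γ(W, U) ((e.symm b) ^ p) := hx.pow p
    rw [hc] at h1
    exact (isIntegral_algebraMap_iff (algebraMap W.functionField L).injective).mp h1
  obtain ⟨a, ha⟩ := IsIntegrallyClosed.algebraMap_eq_of_integral hcint
  refine ⟨a, ?_⟩
  calc (b : Γ(Spec (.of L), fromSpecExtension W L ⁻¹ᵁ U)) ^ p
        = e (e.symm ((b : Γ(Spec (.of L), fromSpecExtension W L ⁻¹ᵁ U)) ^ p)) :=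
          (e.apply_symm_apply _).symm
    _ = e (algebraMap W.functionField L c) := by rw [map_pow, hc]
    _ = e (algebraMap Γ(W, U) L a) := by rw [← ha, ← IsScalarTower.algebraMap_apply]
    _ = algebraMap Γ(W, U) _ a := e.commutes a
    _ = (fromSpecExtension W L).app U a := rfl

/-- **The normalization of a normal integral scheme `W` in a purely inseparable extension of
degree `p = char K(W)` of its function field is universally injective (radicial) over `W`.**
Universal injectivity is Zariski-local on `W`; over a non-empty affine open `U = Spec A` the
normalization morphism is `Spec C → Spec A` with `C` the integral closure of `A` in `L`, and
`C^p ⊆ A` (`exists_pow_eq_app`), so `universallyInjective_SpecMap_of_forall_pow_eq` applies.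
[folklore] -/
theorem universallyInjective_normalizationInι (hp : p.Prime) [CharP W.functionField p]
    [IsPurelyInseparable W.functionField L] (hdeg : Module.finrank W.functionField L = p)
    (hW : ∀ x : W, IsIntegrallyClosed (W.presheaf.stalk x)) :
    UniversallyInjective (normalizationInι W L) := by
  haveI : ExpChar W.functionField p := ExpChar.prime hp
  refine IsZariskiLocalAtTarget.of_iSup_eq_top (P := @UniversallyInjective) _
    (iSup_nonempty_affineOpens_eq_top W) fun U => ?_
  haveI : Nonempty (U.1 : W.Opens) := U.2
  change UniversallyInjective
    ((fromSpecExtension W L).fromNormalization ∣_ ((U.1 : W.affineOpens) : W.Opens))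
  -- the ring map `A → C` (`C` the integral closure of `A = Γ(W, U)` in `Γ(Spec L, ξ_L⁻¹U)`) is
  -- radicial
  have key : UniversallyInjective
      (Spec.map ((fromSpecExtension W L).normalizationDiagramMap.app (.op U.1))) := by
    haveI : CharP Γ(W, (U.1 : W.Opens)) p :=
      (W.germToFunctionField U.1).hom.charP (W.germToFunctionField_injective U.1) p
    refine universallyInjective_SpecMap_of_forall_pow_eq _ hp fun b => ?_
    obtain ⟨a, ha⟩ := exists_pow_eq_app W L hp hdeg hW U.1 b
    exact ⟨a, Subtype.ext ha⟩
  -- and `ι ∣_ U` is `Spec C → Spec A` up to the chart of the relative normalization over `U`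
  exact universallyInjective_morphismRestrict_of_chart _ U.1.2
    ((fromSpecExtension W L).normalizationOpenCover.f U.1)
    (hci := inferInstanceAs
      (IsOpenImmersion ((fromSpecExtension W L).normalizationOpenCover.f U.1)))
    _ ((fromSpecExtension W L).fromNormalization_preimage U.1)
    ((fromSpecExtension W L).ι_fromNormalization U.1) key

end Chart

/-! ## The stub -/

/-- **`Picover` implies its degree-`p` residue.** Given the crux `Picover` (finite universally
injective surjective covers of regular integral separated finite-type `k`-schemes have
resolutions), the normalization `W^L` of a regular integral separated finite-type `k`-scheme `W`
(`char k = p`) in a purely inseparable extension `L ⊇ K(W)` of degree `p` has a resolution: apply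
`Picover` to the normalization morphism `ι : W^L → W`, which is finite (E. Noether), surjective,
and universally injective (`universallyInjective_normalizationInι`: locally `Spec C → Spec A` with
`C^p ⊆ A`). -/
theorem picoverDegP_of_picover : Summit.ResolutionOfSingularities.ResolutionOfSingularities.Theses.PAlteration.Picover → ∀ (p : ℕ), p.Prime → ∀ (k : Type) [Field k] [CharP k p] (W : Scheme.{0}) [IsIntegral W] (f : W ⟶ Spec (.of k)) (L : Type) [Field L] [Algebra W.functionField L], IsSeparated f → LocallyOfFiniteType f → QuasiCompact f → Scheme.IsRegular W → IsPurelyInseparable W.functionField L → Module.finrank W.functionField L = p → Scheme.HasResolution (normalizationIn W L) := by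
  intro hPic p hp k _ _ W _ f L _ _ hsep hlft hqc hWreg hpi hdeg
  haveI := hlft
  haveI : FiniteDimensional W.functionField L := Module.finite_of_finrank_pos (hdeg ▸ hp.pos)
  -- `char K(W) = p`: `K(W)` receives the (injective) composite `k → Γ(W, ⊤) → K(W)`
  haveI : CharP W.functionField p := by
    haveI : Nonempty (⊤ : W.Opens) := ⟨⟨genericPoint W, trivial⟩⟩
    exact (((W.germToFunctionField ⊤).hom.comp
      ((f.appTop).hom.comp (Scheme.ΓSpecIso (.of k)).inv.hom)).charP_iff_charP p).mp inferInstance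
  -- the local rings of the regular scheme `W` are integrally closed
  have hW : ∀ x : W, IsIntegrallyClosed (W.presheaf.stalk x) := fun x =>
    haveI := hWreg x
    isIntegrallyClosed_of_isRegularLocalRing (W.presheaf.stalk x)
  have hfin : IsFinite (normalizationInι W L) := isFinite_normalizationInι W L f
  have hui : UniversallyInjective (normalizationInι W L) :=
    universallyInjective_normalizationInι W L hp hdeg hW
  have hsurj : Function.Surjective (normalizationInι W L).base :=
    (surjective_normalizationInι W L).surj
  exact hPic p hp k W (normalizationIn W L) f (normalizationInι W L) hsep hlft hqc inferInstance
    hWreg inferInstance hfin hui hsurj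

end Summit.ResolutionOfSingularities.ResolutionOfSingularities.Theorems.Picover.DegPOfPicover

end
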